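import Summits.Ventures.CertifiedManyBodySolver.Downfold.PressureAxis
import Summits.Ventures.CertifiedManyBodySolver.Downfold.InflationComposition
import HarnessLib

/-!
# Integer descriptors on a pressure interval: sign persistence of band-edge functions, and ratio transport

Venture CertifiedManyBodySolver, cell `pub/hubbard-downfold` (S1 = ROUTER), seat hubbard-downfold-mod-2;
namespace `Summit.Ventures.CertifiedManyBodySolver.Downfold.Inflation`. Companion of
`Downfold.PressureAxis` (`router/INFLATION-RULES.md` §P.12, §P.11).

§P.12(e′): a router word may be carried from two computed pressures to the open interval between
them only if the §3 row's INTEGER inputs (`k_EF` = number of bands crossing `E_F`, pocket /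
closed-shell guards, band counts in a window) are the same at every pressure in between. Each such
integer is a function of the SIGN PATTERN of finitely many band-edge functions
`g i (u) = E_i(u) - E_F(u)` (band tops / bottoms relative to the Fermi level) along the axis
`u ∈ [a, b]` (`u = P`, `V` or `log V`; statements are parametrisation-free). §1–§2 prove the
certificate used on the bus (run-7 #38, mod-2 INBOX 2026-08-27T00:29Z): **if an edge function keeps
margins `m₁` at `a` and `m₂` at `b` on the same side of zero and its drift rate is bounded,
`|g'| ≤ K` with `K (b - a) < m₁ + m₂`, its sign is constant on `[a, b]`**
(`pos_on_Icc_of_abs_deriv_le₂` / `neg_…`; symmetric-margin forms with `K (b - a) / 2 < m`;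
monotone forms without a rate bound); hence the sign pattern of a finite family is constant
(`sign_iff_of_abs_deriv_le`, `signPattern_eq_of_edges`) and so is ANY descriptor computed from it
(`descriptor_eq_of_edges`; the two counts the router reads: `card_filter_pos_eq_of_edges`
— a pocket-guard count — and `card_filter_cross_eq_of_edges` = `k_EF`) — the kernel form of «integers certified constant by the
band-edge sign test (e′)». §3 is §P.11 step 2′ (RATIO TRANSPORT): a P = 0 enclosure `x₀ ∈ [lo, hi]`
transported by a DFT ratio `r` whose log-error against the true ratio `ρ` is at most `s` encloses
the true value at P: `x₀ ρ ∈ [lo r e^{-s}, hi r e^{s}]` (`mul_ratio_mem_Icc_of_abs_log_sub_le`).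

Everything is PROVED (mean value inequality via `PressureAxis`; `InflationComposition`). WHAT THIS
IS NOT: a statement that any material's band edges obey a given `K` or margin — those are
SCREENING-GRADE numbers read off the runners' band records; the file fixes only what follows.
-/

open Set

namespace Summit.Ventures.CertifiedManyBodySolver.Downfold.Inflation

/-! ## §1 Sign persistence of one edge function on `[a, b]` -/

/-- **Two-margin sign persistence (positive side).** `g` continuous on `[a, b]` with `|g'| ≤ K` on
`(a, b)`, margins `m₁ ≤ g a`, `m₂ ≤ g b` and `K (b - a) < m₁ + m₂` ⇒ `0 < g u` for every
`u ∈ [a, b]` (the two one-sided mean-value bounds added: `2 g u ≥ m₁ + m₂ - K (b - a)`).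
[folklore] -/
theorem pos_on_Icc_of_abs_deriv_le₂ {g g' : ℝ → ℝ} {a b K m₁ m₂ u : ℝ}
    (hcont : ContinuousOn g (Icc a b)) (hder : ∀ x ∈ Ioo a b, HasDerivAt g (g' x) x)
    (hK : ∀ x ∈ Ioo a b, |g' x| ≤ K) (ha : m₁ ≤ g a) (hb : m₂ ≤ g b)
    (hm : K * (b - a) < m₁ + m₂) (hu : u ∈ Icc a b) : 0 < g u := by
  have ha' : g a ∈ Icc m₁ (g a) := ⟨ha, le_rfl⟩
  have hb' : g b ∈ Icc m₂ (g b) := ⟨hb, le_rfl⟩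
  obtain ⟨l1, -⟩ := mem_Icc_of_abs_deriv_le_left hcont hder hK ha' hu
  obtain ⟨l2, -⟩ := mem_Icc_of_abs_deriv_le_right hcont hder hK hb' hu
  have hsum : K * (u - a) + K * (b - u) = K * (b - a) := by ring
  linarith

/-- **Two-margin sign persistence (negative side).** `g a ≤ -m₁`, `g b ≤ -m₂`, `|g'| ≤ K`,
`K (b - a) < m₁ + m₂` ⇒ `g u < 0` on `[a, b]`. [folklore] -/
theorem neg_on_Icc_of_abs_deriv_le₂ {g g' : ℝ → ℝ} {a b K m₁ m₂ u : ℝ}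
    (hcont : ContinuousOn g (Icc a b)) (hder : ∀ x ∈ Ioo a b, HasDerivAt g (g' x) x)
    (hK : ∀ x ∈ Ioo a b, |g' x| ≤ K) (ha : g a ≤ -m₁) (hb : g b ≤ -m₂)
    (hm : K * (b - a) < m₁ + m₂) (hu : u ∈ Icc a b) : g u < 0 := by
  have ha' : g a ∈ Icc (g a) (-m₁) := ⟨le_rfl, ha⟩
  have hb' : g b ∈ Icc (g b) (-m₂) := ⟨le_rfl, hb⟩
  obtain ⟨-, r1⟩ := mem_Icc_of_abs_deriv_le_left hcont hder hK ha' hu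
  obtain ⟨-, r2⟩ := mem_Icc_of_abs_deriv_le_right hcont hder hK hb' hu
  have hsum : K * (u - a) + K * (b - u) = K * (b - a) := by ring
  linarith

/-- **Symmetric-margin form (positive side)**: the same margin `m` at both computed points and
`K (b - a) / 2 < m` (drift over HALF the spacing below the margin — the worst case dips in the
middle) ⇒ `0 < g u` on `[a, b]`. [folklore] -/
theorem pos_on_Icc_of_abs_deriv_le {g g' : ℝ → ℝ} {a b K m u : ℝ}
    (hcont : ContinuousOn g (Icc a b)) (hder : ∀ x ∈ Ioo a b, HasDerivAt g (g' x) x)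
    (hK : ∀ x ∈ Ioo a b, |g' x| ≤ K) (ha : m ≤ g a) (hb : m ≤ g b)
    (hm : K * ((b - a) / 2) < m) (hu : u ∈ Icc a b) : 0 < g u :=
  pos_on_Icc_of_abs_deriv_le₂ hcont hder hK ha hb (by linarith) hu

/-- **Symmetric-margin form (negative side)**: `g a ≤ -m`, `g b ≤ -m`, `K (b - a) / 2 < m` ⇒
`g u < 0` on `[a, b]`. [folklore] -/
theorem neg_on_Icc_of_abs_deriv_le {g g' : ℝ → ℝ} {a b K m u : ℝ}
    (hcont : ContinuousOn g (Icc a b)) (hder : ∀ x ∈ Ioo a b, HasDerivAt g (g' x) x)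
    (hK : ∀ x ∈ Ioo a b, |g' x| ≤ K) (ha : g a ≤ -m) (hb : g b ≤ -m)
    (hm : K * ((b - a) / 2) < m) (hu : u ∈ Icc a b) : g u < 0 :=
  neg_on_Icc_of_abs_deriv_le₂ hcont hder hK ha hb (by linarith) hu

/-- **Monotone edge, no rate bound needed**: an edge function that is monotone or antitone on
`[a, b]` (a sign-definite coordinate, §P.12(a)) and positive at both computed points is positive in
between. [folklore] -/
theorem pos_on_Icc_of_monotoneOn_or_antitoneOn {g : ℝ → ℝ} {a b u : ℝ}
    (hg : MonotoneOn g (Icc a b) ∨ AntitoneOn g (Icc a b)) (ha : 0 < g a) (hb : 0 < g b)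
    (hu : u ∈ Icc a b) : 0 < g u := by
  have ha' : g a ∈ Icc (g a) (g a) := ⟨le_rfl, le_rfl⟩
  have hb' : g b ∈ Icc (g b) (g b) := ⟨le_rfl, le_rfl⟩
  obtain ⟨l, -⟩ := mem_Icc_min_max_of_monotoneOn_or_antitoneOn hg ha' hb' hu
  exact (lt_min ha hb).trans_le l

/-- Monotone or antitone edge, negative at both computed points ⇒ negative in between.
[folklore] -/
theorem neg_on_Icc_of_monotoneOn_or_antitoneOn {g : ℝ → ℝ} {a b u : ℝ}
    (hg : MonotoneOn g (Icc a b) ∨ AntitoneOn g (Icc a b)) (ha : g a < 0) (hb : g b < 0)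
    (hu : u ∈ Icc a b) : g u < 0 := by
  have ha' : g a ∈ Icc (g a) (g a) := ⟨le_rfl, le_rfl⟩
  have hb' : g b ∈ Icc (g b) (g b) := ⟨le_rfl, le_rfl⟩
  obtain ⟨-, r⟩ := mem_Icc_min_max_of_monotoneOn_or_antitoneOn hg ha' hb' hu
  exact r.trans_lt (max_lt ha hb)

/-- **The sign test of §P.12(e′) for one edge (positive-side reading).** `|g'| ≤ K` on `(a, b)`,
`g` continuous on `[a, b]`, the edge keeps a margin `m` from zero at both computed points
(`m ≤ |g a|`, `m ≤ |g b|`) on the SAME side (`0 < g a ↔ 0 < g b`), and `K (b - a) / 2 < m`: then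
at every `u ∈ [a, b]` the edge is on the positive side iff it is at `a`. [folklore] -/
theorem sign_iff_of_abs_deriv_le {g g' : ℝ → ℝ} {a b K m u : ℝ}
    (hcont : ContinuousOn g (Icc a b)) (hder : ∀ x ∈ Ioo a b, HasDerivAt g (g' x) x)
    (hK : ∀ x ∈ Ioo a b, |g' x| ≤ K) (hma : m ≤ |g a|) (hmb : m ≤ |g b|)
    (hside : (0 < g a ↔ 0 < g b)) (hm : K * ((b - a) / 2) < m) (hu : u ∈ Icc a b) :
    (0 < g u ↔ 0 < g a) := by
  by_cases hpos : 0 < g a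
  · have hbpos : 0 < g b := hside.1 hpos
    have ha' : m ≤ g a := by rwa [abs_of_pos hpos] at hma
    have hb' : m ≤ g b := by rwa [abs_of_pos hbpos] at hmb
    exact ⟨fun _ => hpos, fun _ => pos_on_Icc_of_abs_deriv_le hcont hder hK ha' hb' hm hu⟩
  · have hbnp : ¬ 0 < g b := fun h => hpos (hside.2 h)
    have ha0 : g a ≤ 0 := le_of_not_gt hpos
    have hb0 : g b ≤ 0 := le_of_not_gt hbnp
    have ha' : g a ≤ -m := by rw [abs_of_nonpos ha0] at hma; linarith
    have hb' : g b ≤ -m := by rw [abs_of_nonpos hb0] at hmb; linarith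
    have hneg := neg_on_Icc_of_abs_deriv_le hcont hder hK ha' hb' hm hu
    exact ⟨fun h => absurd h (not_lt.2 hneg.le), fun h => absurd h hpos⟩

/-- **The sign test, negative-side reading**: under the same hypotheses the edge is on the
negative side at `u` iff it is at `a`. [folklore] -/
theorem neg_iff_of_abs_deriv_le {g g' : ℝ → ℝ} {a b K m u : ℝ}
    (hcont : ContinuousOn g (Icc a b)) (hder : ∀ x ∈ Ioo a b, HasDerivAt g (g' x) x)
    (hK : ∀ x ∈ Ioo a b, |g' x| ≤ K) (hma : m ≤ |g a|) (hmb : m ≤ |g b|)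
    (hside : (0 < g a ↔ 0 < g b)) (hm : K * ((b - a) / 2) < m) (hu : u ∈ Icc a b) :
    (g u < 0 ↔ g a < 0) := by
  by_cases hpos : 0 < g a
  · have hbpos : 0 < g b := hside.1 hpos
    have ha' : m ≤ g a := by rwa [abs_of_pos hpos] at hma
    have hb' : m ≤ g b := by rwa [abs_of_pos hbpos] at hmb
    have hp := pos_on_Icc_of_abs_deriv_le hcont hder hK ha' hb' hm hu
    exact ⟨fun h => absurd h (not_lt.2 hp.le), fun h => absurd h (not_lt.2 hpos.le)⟩
  · have hbnp : ¬ 0 < g b := fun h => hpos (hside.2 h)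
    have ha0 : g a ≤ 0 := le_of_not_gt hpos
    have hb0 : g b ≤ 0 := le_of_not_gt hbnp
    have ha' : g a ≤ -m := by rw [abs_of_nonpos ha0] at hma; linarith
    have hb' : g b ≤ -m := by rw [abs_of_nonpos hb0] at hmb; linarith
    have hneg := neg_on_Icc_of_abs_deriv_le hcont hder hK ha' hb' hm hu
    have hab : a ≤ b := hu.1.trans hu.2
    have hm0 : 0 < m := by
      rcases eq_or_lt_of_le hab with h | h
      · have : K * ((b - a) / 2) = 0 := by rw [h]; ring
        linarith
      · have hx : (a + b) / 2 ∈ Ioo a b := ⟨by linarith, by linarith⟩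
        have hK0 : 0 ≤ K := (abs_nonneg _).trans (hK _ hx)
        nlinarith
    exact ⟨fun _ => by linarith, fun _ => hneg⟩

/-! ## §2 A finite family of edges: the sign pattern and every descriptor computed from it -/

/-- **Sign pattern constant on the interval.** For a family of edge functions `g i` each passing
the sign test of `sign_iff_of_abs_deriv_le` (rate bounds `K i`, margins `m i`), the pattern
«which edges are on the positive side» at any `u ∈ [a, b]` equals the pattern at `a`. [folklore] -/
theorem signPattern_eq_of_edges {ι : Type*} {g g' : ι → ℝ → ℝ} {a b u : ℝ} {K m : ι → ℝ}
    (hcont : ∀ i, ContinuousOn (g i) (Icc a b))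
    (hder : ∀ i, ∀ x ∈ Ioo a b, HasDerivAt (g i) (g' i x) x)
    (hK : ∀ i, ∀ x ∈ Ioo a b, |g' i x| ≤ K i) (hma : ∀ i, m i ≤ |g i a|)
    (hmb : ∀ i, m i ≤ |g i b|) (hside : ∀ i, (0 < g i a ↔ 0 < g i b))
    (hm : ∀ i, K i * ((b - a) / 2) < m i) (hu : u ∈ Icc a b) :
    (fun i => 0 < g i u) = fun i => 0 < g i a := by
  funext i
  exact propext (sign_iff_of_abs_deriv_le (hcont i) (hder i) (hK i) (hma i) (hmb i) (hside i)
    (hm i) hu)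

/-- **Every descriptor computed from the sign pattern is constant on the interval** (the integer
inputs of a ROUTER §3 row: `k_EF`, pocket / closed-shell guards, band counts in a window — each a
function `F` of which edges lie above / below `E_F`). [folklore] -/
theorem descriptor_eq_of_edges {ι α : Type*} (F : (ι → Prop) → α) {g g' : ι → ℝ → ℝ}
    {a b u : ℝ} {K m : ι → ℝ} (hcont : ∀ i, ContinuousOn (g i) (Icc a b))
    (hder : ∀ i, ∀ x ∈ Ioo a b, HasDerivAt (g i) (g' i x) x)
    (hK : ∀ i, ∀ x ∈ Ioo a b, |g' i x| ≤ K i) (hma : ∀ i, m i ≤ |g i a|)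
    (hmb : ∀ i, m i ≤ |g i b|) (hside : ∀ i, (0 < g i a ↔ 0 < g i b))
    (hm : ∀ i, K i * ((b - a) / 2) < m i) (hu : u ∈ Icc a b) :
    F (fun i => 0 < g i u) = F (fun i => 0 < g i a) :=
  congrArg F (signPattern_eq_of_edges hcont hder hK hma hmb hside hm hu)

open Classical in
/-- **A positive-side count is constant on the interval** (e.g. the number of watched band
bottoms above `E_F` — what a pocket guard reads) when every watched edge passes the sign test.
[folklore] -/
theorem card_filter_pos_eq_of_edges {ι : Type*} (s : Finset ι) {g g' : ι → ℝ → ℝ} {a b u : ℝ}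
    {K m : ι → ℝ} (hcont : ∀ i, ContinuousOn (g i) (Icc a b))
    (hder : ∀ i, ∀ x ∈ Ioo a b, HasDerivAt (g i) (g' i x) x)
    (hK : ∀ i, ∀ x ∈ Ioo a b, |g' i x| ≤ K i) (hma : ∀ i, m i ≤ |g i a|)
    (hmb : ∀ i, m i ≤ |g i b|) (hside : ∀ i, (0 < g i a ↔ 0 < g i b))
    (hm : ∀ i, K i * ((b - a) / 2) < m i) (hu : u ∈ Icc a b) :
    (s.filter fun i => 0 < g i u).card = (s.filter fun i => 0 < g i a).card := by
  rw [Finset.filter_congr (fun i _ => sign_iff_of_abs_deriv_le (hcont i) (hder i) (hK i) (hma i)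
    (hmb i) (hside i) (hm i) hu)]

open Classical in
/-- **`k_EF` is constant on the interval.** The number of bands of the finite set `s` CROSSING the
Fermi level (bottom edge `bot i` below zero and top edge `top i` above zero, both relative to
`E_F`; ROUTER §2 D4/D6) is the same at every `u ∈ [a, b]` as at `a` when every bottom and top edge
passes the sign test — the (e′) certificate of `router/INFLATION-RULES.md` §P.12: «same §3 row at
both ends» includes the row's integer inputs, and this is what certifies them BETWEEN the ends.
[folklore] -/
theorem card_filter_cross_eq_of_edges {ι : Type*} (s : Finset ι)
    {bot bot' top top' : ι → ℝ → ℝ} {a b u : ℝ} {Kb mb Kt mt : ι → ℝ}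
    (hbc : ∀ i, ContinuousOn (bot i) (Icc a b))
    (hbd : ∀ i, ∀ x ∈ Ioo a b, HasDerivAt (bot i) (bot' i x) x)
    (hbK : ∀ i, ∀ x ∈ Ioo a b, |bot' i x| ≤ Kb i) (hbma : ∀ i, mb i ≤ |bot i a|)
    (hbmb : ∀ i, mb i ≤ |bot i b|) (hbside : ∀ i, (0 < bot i a ↔ 0 < bot i b))
    (hbm : ∀ i, Kb i * ((b - a) / 2) < mb i)
    (htc : ∀ i, ContinuousOn (top i) (Icc a b))
    (htd : ∀ i, ∀ x ∈ Ioo a b, HasDerivAt (top i) (top' i x) x)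
    (htK : ∀ i, ∀ x ∈ Ioo a b, |top' i x| ≤ Kt i) (htma : ∀ i, mt i ≤ |top i a|)
    (htmb : ∀ i, mt i ≤ |top i b|) (htside : ∀ i, (0 < top i a ↔ 0 < top i b))
    (htm : ∀ i, Kt i * ((b - a) / 2) < mt i) (hu : u ∈ Icc a b) :
    (s.filter fun i => bot i u < 0 ∧ 0 < top i u).card
      = (s.filter fun i => bot i a < 0 ∧ 0 < top i a).card := by
  rw [Finset.filter_congr (fun i _ => Iff.and
    (neg_iff_of_abs_deriv_le (hbc i) (hbd i) (hbK i) (hbma i) (hbmb i) (hbside i) (hbm i) hu)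
    (sign_iff_of_abs_deriv_le (htc i) (htd i) (htK i) (htma i) (htmb i) (htside i) (htm i) hu))]

/-! ## §3 Ratio transport (§P.11 step 2′) -/

/-- **RATIO TRANSPORT.** A P = 0 enclosure `x₀ ∈ [lo, hi]` (`0 ≤ lo`) of a positive coordinate,
transported to P by the TRUE structural ratio `ρ > 0`, is enclosed by the DFT ratio `r > 0` padded
by the log-error `s` of the increment (`|log ρ - log r| ≤ s`):
`x₀ ρ ∈ [lo r e^{-s}, hi r e^{s}]` — the P = 0 offsets of the structure members sit in `[lo, hi]`
and only the INCREMENT error is padded. [folklore] -/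
theorem mul_ratio_mem_Icc_of_abs_log_sub_le {x₀ ρ r lo hi s : ℝ} (hx : x₀ ∈ Icc lo hi)
    (hlo : 0 ≤ lo) (hρ : 0 < ρ) (hr : 0 < r) (hs : |Real.log ρ - Real.log r| ≤ s) :
    x₀ * ρ ∈ Icc (lo * (r * Real.exp (-s))) (hi * (r * Real.exp s)) := by
  have h1 : |Real.log (ρ / r)| ≤ s := by rwa [Real.log_div hρ.ne' hr.ne']
  obtain ⟨h2, h3⟩ := exp_neg_le_of_abs_log_le (div_pos hρ hr) h1
  have e : r * (ρ / r) = ρ := by field_simp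
  have hρmem : ρ ∈ Icc (r * Real.exp (-s)) (r * Real.exp s) := by
    constructor
    · have := mul_le_mul_of_nonneg_left h2 hr.le
      rwa [e] at this
    · have := mul_le_mul_of_nonneg_left h3 hr.le
      rwa [e] at this
  exact mul_mem_Icc_mul hx hρmem hlo (by positivity)

/-- **The floor covers the increment error** (§P.11 step 2′, the arithmetic): a coordinate with
log-volume sensitivity `S ≥ 0` and a DFT increment whose log-volume error is at most a fraction
`c` of the spacing `L` needs the pad `S (c L)`; whenever `c L ≤ Δ` (the at-point floor, `0.03`)
that pad is at most the at-point pad `S Δ` already carried. [folklore] -/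
theorem increment_pad_le_floor {S c L Δ : ℝ} (hS : 0 ≤ S) (hcL : c * L ≤ Δ) :
    S * (c * L) ≤ S * Δ :=
  mul_le_mul_of_nonneg_left hcL hS

/-! ## §4 One-sided sign persistence (EXTRAPOLATION beyond the last computed point, §P.12(c′)) -/

/-- **One-sided sign persistence from the LEFT end (positive side).** `g` continuous on `[a, b]`,
`|g'| ≤ K` on `(a, b)`, margin `m ≤ g a` at the computed point and `K (b - a) < m` (the drift over
the WHOLE extrapolation span stays below the margin) ⇒ `0 < g u` on `[a, b]`: the edge keeps its
side beyond the last computed point, so the integer it feeds is the one read at `a`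
(§P.12(c′)(iii)). [folklore] -/
theorem pos_on_Icc_of_abs_deriv_le_left {g g' : ℝ → ℝ} {a b K m u : ℝ}
    (hcont : ContinuousOn g (Icc a b)) (hder : ∀ x ∈ Ioo a b, HasDerivAt g (g' x) x)
    (hK : ∀ x ∈ Ioo a b, |g' x| ≤ K) (ha : m ≤ g a) (hm : K * (b - a) < m)
    (hu : u ∈ Icc a b) : 0 < g u := by
  have ha' : g a ∈ Icc m (g a) := ⟨ha, le_rfl⟩
  obtain ⟨l, -⟩ := mem_Icc_of_abs_deriv_le_left hcont hder hK ha' hu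
  rcases eq_or_lt_of_le (hu.1.trans hu.2) with h | h
  · subst h
    have hu' : u = a := le_antisymm hu.2 hu.1
    subst hu'
    simp only [sub_self, mul_zero] at hm l
    linarith
  · have hx : (a + b) / 2 ∈ Ioo a b := ⟨by linarith, by linarith⟩
    have hK0 : 0 ≤ K := (abs_nonneg _).trans (hK _ hx)
    have hmono : K * (u - a) ≤ K * (b - a) := mul_le_mul_of_nonneg_left (by linarith [hu.2]) hK0
    linarith

/-- **One-sided sign persistence from the LEFT end (negative side)**: `g a ≤ -m`, `|g'| ≤ K`,
`K (b - a) < m` ⇒ `g u < 0` on `[a, b]`. [folklore] -/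
theorem neg_on_Icc_of_abs_deriv_le_left {g g' : ℝ → ℝ} {a b K m u : ℝ}
    (hcont : ContinuousOn g (Icc a b)) (hder : ∀ x ∈ Ioo a b, HasDerivAt g (g' x) x)
    (hK : ∀ x ∈ Ioo a b, |g' x| ≤ K) (ha : g a ≤ -m) (hm : K * (b - a) < m)
    (hu : u ∈ Icc a b) : g u < 0 := by
  have ha' : g a ∈ Icc (g a) (-m) := ⟨le_rfl, ha⟩
  obtain ⟨-, r⟩ := mem_Icc_of_abs_deriv_le_left hcont hder hK ha' hu
  rcases eq_or_lt_of_le (hu.1.trans hu.2) with h | h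
  · subst h
    have hu' : u = a := le_antisymm hu.2 hu.1
    subst hu'
    simp only [sub_self, mul_zero, add_zero] at hm r
    linarith
  · have hx : (a + b) / 2 ∈ Ioo a b := ⟨by linarith, by linarith⟩
    have hK0 : 0 ≤ K := (abs_nonneg _).trans (hK _ hx)
    have hmono : K * (u - a) ≤ K * (b - a) := mul_le_mul_of_nonneg_left (by linarith [hu.2]) hK0
    linarith

/-- **One-sided sign persistence from the RIGHT end (positive side)** (extrapolation BELOW the
first computed point `b`): `m ≤ g b`, `|g'| ≤ K`, `K (b - a) < m` ⇒ `0 < g u` on `[a, b]`.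
[folklore] -/
theorem pos_on_Icc_of_abs_deriv_le_right {g g' : ℝ → ℝ} {a b K m u : ℝ}
    (hcont : ContinuousOn g (Icc a b)) (hder : ∀ x ∈ Ioo a b, HasDerivAt g (g' x) x)
    (hK : ∀ x ∈ Ioo a b, |g' x| ≤ K) (hb : m ≤ g b) (hm : K * (b - a) < m)
    (hu : u ∈ Icc a b) : 0 < g u := by
  have hb' : g b ∈ Icc m (g b) := ⟨hb, le_rfl⟩
  obtain ⟨l, -⟩ := mem_Icc_of_abs_deriv_le_right hcont hder hK hb' hu
  rcases eq_or_lt_of_le (hu.1.trans hu.2) with h | h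
  · subst h
    have hu' : u = a := le_antisymm hu.2 hu.1
    subst hu'
    simp only [sub_self, mul_zero] at hm l
    linarith
  · have hx : (a + b) / 2 ∈ Ioo a b := ⟨by linarith, by linarith⟩
    have hK0 : 0 ≤ K := (abs_nonneg _).trans (hK _ hx)
    have hmono : K * (b - u) ≤ K * (b - a) := mul_le_mul_of_nonneg_left (by linarith [hu.1]) hK0
    linarith

/-- **The one-sided sign test**: margin `m ≤ |g a|` at the last computed point, `|g'| ≤ K`,
`K (b - a) < m` ⇒ at every `u ∈ [a, b]` the edge is on the positive side iff it is at `a`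
(so every descriptor computed from the sign pattern extrapolates unchanged over `[a, b]`).
[folklore] -/
theorem sign_iff_of_abs_deriv_le_left {g g' : ℝ → ℝ} {a b K m u : ℝ}
    (hcont : ContinuousOn g (Icc a b)) (hder : ∀ x ∈ Ioo a b, HasDerivAt g (g' x) x)
    (hK : ∀ x ∈ Ioo a b, |g' x| ≤ K) (hma : m ≤ |g a|) (hm : K * (b - a) < m)
    (hu : u ∈ Icc a b) : (0 < g u ↔ 0 < g a) := by
  by_cases hpos : 0 < g a
  · have ha' : m ≤ g a := by rwa [abs_of_pos hpos] at hma
    exact ⟨fun _ => hpos, fun _ => pos_on_Icc_of_abs_deriv_le_left hcont hder hK ha' hm hu⟩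
  · have ha0 : g a ≤ 0 := le_of_not_gt hpos
    have ha' : g a ≤ -m := by rw [abs_of_nonpos ha0] at hma; linarith
    have hneg := neg_on_Icc_of_abs_deriv_le_left hcont hder hK ha' hm hu
    exact ⟨fun h => absurd h (not_lt.2 hneg.le), fun h => absurd h hpos⟩

/-! ## §5 Why no hull is formed across a structural transition (§P.12(h)) -/

/-- **Piecewise monotonicity does not give the hull across a jump.** The coordinate
`f u = if u < 1/2 then 0 else 3 - 2u` on `[0, 1]` is monotone on each of the two structure
"phases" `[0, 1/2)` and `[1/2, 1]`, its end-point values are `f 0 = 0` and `f 1 = 1`, yet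
`f (1/2) = 2 ∉ [0, 1]` = the hull of the end-point values: a reset at the transition (`u = 1/2`)
escapes the hull although nothing is non-monotone WITHIN a phase. This is the reason §P.12(h)
forms NO interval row across a printed structural transition `P*` — rule (a)'s premise
(monotone on the WHOLE interval) is a within-phase statement. [folklore] -/
theorem exists_piecewise_monotone_not_mem_hull :
    ∃ f : ℝ → ℝ, MonotoneOn f (Ico (0 : ℝ) (1 / 2)) ∧ AntitoneOn f (Icc (1 / 2 : ℝ) 1) ∧
      f 0 = 0 ∧ f 1 = 1 ∧ f (1 / 2) ∉ Icc (min (f 0) (f 1)) (max (f 0) (f 1)) := by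
  refine ⟨fun u => if u < 1 / 2 then 0 else 3 - 2 * u, ?_, ?_, ?_, ?_, ?_⟩
  · intro x hx y hy _
    simp only [hx.2, hy.2, if_true, le_refl]
  · intro x hx y hy hxy
    have hx' : ¬ x < 1 / 2 := not_lt.2 hx.1
    have hy' : ¬ y < 1 / 2 := not_lt.2 hy.1
    simp only [hx', hy', if_false]
    linarith
  · norm_num
  · norm_num
  · norm_num

end Summit.Ventures.CertifiedManyBodySolver.Downfold.Inflation
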